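import Summits.Ventures.YMGap.YM4Door.StripDoor

/-!
# YM4Door / StripCells — H-b re-typed for Track A (`SU2.GibbsFormAtStripDoor` ⇒ `SU2.BlockClusters`), non-vacuity (pure Wilson is at the
# strip door of every cell), THE COMPLETE STRIP TABLE (every certified cell in Bałaban's currency)

HONEST FRAMING (cell `ym-beyond`, seat P2 «strong-coupling bridge», HUMAN RULING D-0035 / D-0037; g8 tree edition, 2026-08-25, split into
≤ 400-line modules for the gate; memo `HOME/ROUTE-P2.md` v0.8, spec `HOME/ROUTE-P2-LIFT-SPEC.md` v2).  LATTICE / finite-torus bookkeeping only: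
nothing here is a continuum, spectral or Clay-sense statement; nothing here moves the weak-coupling exit of Track A (uncertified); nothing
here is a part of Bałaban's theorems; NO effective action is asserted to be at any door.  NO conjecture name, NO `sorry`, NO axiom beyond
the standard three; label K = kernel bookkeeping.

Continuation of `YM4Door/StripDoor.lean` (its header is the reference): §5 `SU2.ρ2`, `SU2.InStripFormat`, `SU2.BlockClusters`,
`SU2.GibbsFormAtStripDoor`, `SU2.blockClusters_of_gibbsFormAtStripDoor` and the per-cell corollaries; §6 non-vacuity; §7 the cell menu `DoorCell`,
the tree rows per cell (`doorCell_*`), `DoorCell.mono`, the strip numbers per cell and `SU2.blockClusters_of_stripDoor_*`.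
References: as in `StripDoor.lean` (T. Bałaban, CMP 119 (1988) §2 [Balaban1988Convergent]; CMP 122 (1989) [Balaban1989LargeFieldII]).
-/

noncomputable section

open MeasureTheory Finset Function Metric
open scoped Matrix.Norms.Frobenius
open Literature.Probability.LatticeModels Literature.Probability.LatticeModels.DobrushinMetric
open Literature.MathematicalPhysics.QuantumLattice hiding torusNorm configShift
open Literature.MathematicalPhysics.QuantumFieldTheory hiding ZdEdge
open Summit.Ventures.YMGap.RobustBall
open Summit.Ventures.YMGap.StarResolventDim (Delta gaugeR doorPoly)
open Summit.Ventures.YMGap.YM3IR.ReceiverWitness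

namespace Summit.Ventures.YMGap.YM4Door

variable {d L N : ℕ} [NeZero L]

/-! ## §5  H-b re-typed for Track A: «Gibbs form at the STRIP door» ⇒ block-level clustering -/

/-- g4's **certified DOOR CELL** `(β₀; ε₀, ε₁)` for `SU(2)`, `d = 4` (first typed in HOME `ROUTE-P2-SketchDoor.lean` §2, g4). -/
@[folklore] def DoorCell (β₀ ε₀ ε₁ : ℝ) : Prop :=
  ∀ κ : ℝ, 1 / 100 ≤ κ → ∀ β : ℝ, 0 ≤ β → β ≤ β₀ →
    TorusClusteringOnBallW 2 4 β κ ε₀ ε₁ (16 * Real.exp (1 / 50)) (1 / 100)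

/-- Tree cell `β_W,eff ≤ 1/8`: tree `β₀ = 1/16`, loads `(73/250, 73/500)`. -/
theorem doorCell_oneEighth : DoorCell (1 / 16) (73 / 250) (73 / 500) :=
  su2_torusClusteringOnBallW_star_oneEighth_t100

/-- Tree cell `β_W,eff ≤ 1/3`: tree `β₀ = 1/6`, loads `(11/500, 11/1000)`. -/
theorem doorCell_oneThird : DoorCell (1 / 6) (11 / 500) (11 / 1000) :=
  su2_torusClusteringOnBallW_star_oneThird_t100

/-- Tree cell `β_W,eff ≤ 1/6`: tree `β₀ = 1/12`, loads `(11/50, 11/100)`. -/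
theorem doorCell_oneSixth : DoorCell (1 / 12) (11 / 50) (11 / 100) :=
  su2_torusClusteringOnBallW_star_oneSixth_t100

/-- g4's Haar-basin cell: `β₀ = 0`, any `ε₀ ≥ 0`, `ε₁ = 1/3`. -/
theorem doorCell_haar {ε₀ : ℝ} (hε₀ : 0 ≤ ε₀) : DoorCell 0 ε₀ (1 / 3) := by
  intro κ hκ β hβ0 hβ
  obtain rfl : β = 0 := le_antisymm hβ hβ0
  exact su2_torusClusteringOnBallW_star_haar_t100 κ hκ ε₀ hε₀

namespace SU2

/-- The fundamental representation of `SU(2)`. -/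
abbrev ρ2 : SUN 2 →* Matrix (Fin 2) (Fin 2) ℂ := fundamentalRep (Fin 2)

variable {b S : ℕ} [NeZero b] [NeZero S]

/-- **IN STRIP FORMAT** `(r, κ, B₀)`: the terms of the effective action are in Bałaban's format (ii)+(iv) ON THE STRIP of width
`r` at rate `κ` with (2.42)-norm `B₀`, and their supports are thin (connected localization domains). -/
@[folklore] def InStripFormat (𝓔 : BalabanEffectiveAction 4 S (SUN 2) 1) (r κ B₀ : ℝ) : Prop :=
  𝓔.terms.HasAnalyticNormLE ρ2 (fun _ => stripDomain ρ2 r) κ B₀ ∧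
    ∀ X, 𝓔.terms.act X ≠ 0 → (polymerDiam X : ℝ) ≤ (X.card : ℝ) - 1

/-- **Every cell is fed by the strip format**: coupling in `[0, β₀]`, strip format `(r, κ, B₀)` with `κ ≥ 1/100 + δ`,
`2B₀ ≤ ε₀`, `8B₀/(eδr) ≤ ε₁` ⇒ the effective Gibbs law clusters at `(16 e^{1/50}, 1/100)` on every block torus `S ≥ 3`. -/
theorem clustersWith_of_inStripFormat (hS : 3 ≤ S) {β₀ ε₀ ε₁ : ℝ} (hcell : DoorCell β₀ ε₀ ε₁)
    (𝓔 : BalabanEffectiveAction 4 S (SUN 2) 1) {r κ B₀ δ : ℝ} (hβ0 : 0 ≤ 𝓔.β) (hβ : 𝓔.β ≤ β₀)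
    (hF : InStripFormat 𝓔 r κ B₀) (hr : 0 < r) (hδ : 0 < δ) (hκ : 1 / 100 + δ ≤ κ)
    (h₀ : 2 * B₀ ≤ ε₀) (h₁ : 8 / (Real.exp 1 * δ * r) * B₀ ≤ ε₁) :
    ClustersWith 𝓔.terms 𝓔.β (16 * Real.exp (1 / 50)) (1 / 100) := by
  have h₁' : 2 * ((4 : ℕ) : ℝ) / (Real.exp 1 * δ * r) * B₀ ≤ ε₁ := by
    have e : (2 : ℝ) * ((4 : ℕ) : ℝ) = 8 := by norm_num
    rw [e]; exact h₁
  exact clustersWith_of_strip (hcell (1 / 100) le_rfl 𝓔.β hβ0 hβ) hS 𝓔.terms hr hF.1 hF.2 (by norm_num) hδ hκ h₀ h₁'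

/-- g4's **BLOCK-LEVEL IR on one blocking** (first typed in HOME `ROUTE-P2-SketchDoor.lean` §4, g4): the fine Wilson law at
`β` on the torus `b·S`, blocked through `B`, is the Gibbs law of SOME Bałaban-format effective action which clusters at `(A, m)`. -/
@[folklore] def BlockClusters (B : GaugeBlockAveraging 4 (SUN 2) b S) (β A m : ℝ) : Prop :=
  ∃ 𝓔 : BalabanEffectiveAction 4 S (SUN 2) 1, IsBalabanEffectiveActionOf ρ2 B β 𝓔 ∧ ClustersWith 𝓔.terms 𝓔.β A m

/-- ★ **U-LF in strip currency (H-b′): «GIBBS FORM AT THE STRIP DOOR of the cell `(β₀; ε₀, ε₁)`».**  The blocked fine Wilson law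
is the Gibbs law of a Bałaban effective action with effective coupling in `[0, β₀]` and terms in strip format `(r, κ, B₀)`
whose converted loads `(2B₀, 8B₀/(eδr))` fit the cell, for some rate margin `δ > 0` with `κ ≥ 1/100 + δ`.  THIS is the
window-closing target of rungs R2b/R2c stated in the renormalisation-group programme's own norm (Track A memo item). -/
@[folklore] def GibbsFormAtStripDoor (B : GaugeBlockAveraging 4 (SUN 2) b S) (β β₀ ε₀ ε₁ : ℝ) : Prop :=
  ∃ 𝓔 : BalabanEffectiveAction 4 S (SUN 2) 1, IsBalabanEffectiveActionOf ρ2 B β 𝓔 ∧ 0 ≤ 𝓔.β ∧ 𝓔.β ≤ β₀ ∧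
    ∃ r κ B₀ δ : ℝ, 0 < r ∧ 0 < δ ∧ 1 / 100 + δ ≤ κ ∧ InStripFormat 𝓔 r κ B₀ ∧
      2 * B₀ ≤ ε₀ ∧ 8 / (Real.exp 1 * δ * r) * B₀ ≤ ε₁

/-- ★ **Strip door ⇒ block-level IR**, for every certified cell. -/
theorem blockClusters_of_gibbsFormAtStripDoor (hS : 3 ≤ S) {B : GaugeBlockAveraging 4 (SUN 2) b S} {β β₀ ε₀ ε₁ : ℝ}
    (hcell : DoorCell β₀ ε₀ ε₁) (h : GibbsFormAtStripDoor B β β₀ ε₀ ε₁) :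
    BlockClusters B β (16 * Real.exp (1 / 50)) (1 / 100) := by
  obtain ⟨𝓔, h𝓔, hβ0, hβ, r, κ, B₀, δ, hr, hδ, hκ, hF, h₀, h₁⟩ := h
  exact ⟨𝓔, h𝓔, clustersWith_of_inStripFormat hS hcell 𝓔 hβ0 hβ hF hr hδ hκ h₀ h₁⟩

/-- The two cells of §4 plugged in: `β_W,eff ≤ 1/8` … -/
theorem blockClusters_of_stripDoor_oneEighth (hS : 3 ≤ S) {B : GaugeBlockAveraging 4 (SUN 2) b S} {β : ℝ}
    (h : GibbsFormAtStripDoor B β (1 / 16) (73 / 250) (73 / 500)) : BlockClusters B β (16 * Real.exp (1 / 50)) (1 / 100) :=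
  blockClusters_of_gibbsFormAtStripDoor hS doorCell_oneEighth h

/-- … and `β_W,eff ≤ 1/3`. -/
theorem blockClusters_of_stripDoor_oneThird (hS : 3 ≤ S) {B : GaugeBlockAveraging 4 (SUN 2) b S} {β : ℝ}
    (h : GibbsFormAtStripDoor B β (1 / 6) (11 / 500) (11 / 1000)) : BlockClusters B β (16 * Real.exp (1 / 50)) (1 / 100) :=
  blockClusters_of_gibbsFormAtStripDoor hS doorCell_oneThird h

/-- … and the HAAR BASIN: `GibbsFormAtStripDoor B β 0 ε₀ (1/3)` — effective coupling `0`, any oscillation bookkeeping `ε₀`, and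
the one inequality `8B₀/(eδr) ≤ 1/3` — suffices. -/
theorem blockClusters_of_stripDoor_haar (hS : 3 ≤ S) {B : GaugeBlockAveraging 4 (SUN 2) b S} {β ε₀ : ℝ}
    (h : GibbsFormAtStripDoor B β 0 ε₀ (1 / 3)) : BlockClusters B β (16 * Real.exp (1 / 50)) (1 / 100) := by
  obtain ⟨𝓔, h𝓔, hβ0, hβ, r, κ, B₀, δ, hr, hδ, hκ, hF, h₀, h₁⟩ := h
  have hB₀ := eta_nonneg_of_hasAnalyticNormLE_strip 𝓔.terms hr hF.1
  exact blockClusters_of_gibbsFormAtStripDoor hS (doorCell_haar (by linarith))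
    ⟨𝓔, h𝓔, hβ0, hβ, r, κ, B₀, δ, hr, hδ, hκ, hF, h₀, h₁⟩

end SU2

/-! ## §6  Non-vacuity: the pure Wilson action is at the strip door of every cell -/

/-- The zero perturbation is in strip format with norm `0` (any width, any rate). -/
theorem inStripFormat_wilsonAt {S : ℕ} [NeZero S] (β r κ : ℝ) :
    SU2.InStripFormat (BalabanEffectiveAction.wilsonAt (d := 4) (S := S) (G := SUN 2) (c := 1) β) r κ 0 :=
  ⟨QuasiLocalGaugePerturbation.hasAnalyticNormLE_zero _ _ le_rfl, fun _ hX => absurd rfl hX⟩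

/-- Pure Wilson `SU(2)` at tree `β ≤ 1/16` (`β_W ≤ 1/8`) clusters THROUGH THE STRIP DOOR (the first rung of the strong-coupling
expansion recovered in Bałaban's currency; consistency with the tree rows at `W = 0`). -/
theorem clustersWith_wilson_oneEighth {S : ℕ} [NeZero S] (hS : 3 ≤ S) {β : ℝ} (hβ0 : 0 ≤ β) (hβ : β ≤ 1 / 16) :
    ClustersWith (BalabanEffectiveAction.wilsonAt (d := 4) (S := S) (G := SUN 2) (c := 1) β).terms β
      (16 * Real.exp (1 / 50)) (1 / 100) :=
  SU2.clustersWith_of_inStripFormat hS doorCell_oneEighth _ (r := 1) (κ := 1 / 100 + 1) (δ := 1) hβ0 hβ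
    (inStripFormat_wilsonAt β 1 (1 / 100 + 1)) one_pos one_pos le_rfl (by norm_num) (by norm_num)


/-! ## §7 (g6)  THE COMPLETE STRIP TABLE: every certified cell in Bałaban's currency

Cell `(β_W,eff ≤ 2β₀; ε₀, ε₁)` is fed by strip format `(r, κ, η)`, `κ ≥ 1/100 + δ`, iff `η ≤ ε₀/2 ∧ η ≤ ε₁·e·δ·r/8`
(`e/8 ≈ 0.3398`).  The table (tree units `β = β_W/2`; output always `(16 e^{1/50}, 1/100)` on every torus `L ≥ 3`):

| cell `β_W,eff ≤` | tree `β₀` | `(ε₀, ε₁)`          | strip: `η ≤ …` ∧ `η ≤ … · δr` | source                       |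
|------------------|-----------|---------------------|-------------------------------|------------------------------|
| `1/8`            | `1/16`    | `(73/250, 73/500)`  | `0.146` ∧ `0.0496·δr`         | tree row `…_oneEighth_t100`   |
| `1/6`            | `1/12`    | `(11/50, 11/100)`   | `0.11` ∧ `0.0374·δr`          | tree row `…_oneSixth_t100`    |
| `1/5`            | `1/10`    | `(17/100, 17/200)`  | `0.085` ∧ `0.0289·δr`         | tree row `…_oneFifth_t100`    |
| `1/4`            | `1/8`     | `(27/250, 27/500)`  | `0.054` ∧ `0.0183·δr`         | tree row `…_oneQuarter_t100`  |
| `3/10`           | `3/20`    | `(27/500, 27/1000)` | `0.027` ∧ `0.00917·δr`        | tree row `…_threeTenths_t100` |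
| `1/3`            | `1/6`     | `(11/500, 11/1000)` | `0.011` ∧ `0.00374·δr`        | tree row `…_oneThird_t100`    |
| `1/10` (gen.)    | `1/20`    | `(3/10, 17/100)`    | `0.15` ∧ `0.0578·δr`          | g4 `…_oneTenth_gen_t100`      |
| `1/20` (gen.)    | `1/40`    | `(3/10, 1/4)`       | `0.15` ∧ `0.0850·δr`          | g4 `…_oneTwentieth_gen_t100`  |
| `0` (Haar)       | `0`       | `(any, 1/3)`        | — ∧ `0.1133·δr`               | g4 Haar cell (§4b)            |
| basin (§8)       | `|β|`     | —                   | `8η/(eδr) + 102.85·|β| ≤ 1/3` | g4 Wilson price + Haar cell   |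
-/

/-- `e^{3/10} ≤ 134987/100000` (g4, verbatim; Mathlib's `Real.exp_bound'`, five terms). -/
theorem exp_le_3_10_d : Real.exp (3 / 10) ≤ 134987 / 100000 := by
  have h := Real.exp_bound' (x := 3 / 10) (by norm_num) (by norm_num) (n := 5) (by norm_num)
  refine h.trans ?_
  simp only [Finset.sum_range_succ, Finset.sum_range_zero, Nat.factorial]
  norm_num

/-- g4's **generated cell `(β_W; ε₀, ε₁) = (1/20; 3/10, 1/4)`** (verbatim): tree coupling `0 ≤ β ≤ 1/40`, every `κ ≥ 1/100`.
Certificate `c = 2881/100000`, `λ = 35356/100000`, `K = 20`.  HYPOTHESIS-FREE. -/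
theorem su2_torusClusteringOnBallW_star_oneTwentieth_gen_t100 :
    ∀ κ : ℝ, 1 / 100 ≤ κ → ∀ β : ℝ, 0 ≤ β → β ≤ 1 / 40 →
      TorusClusteringOnBallW 2 4 β κ (3 / 10) (1 / 4) (16 * Real.exp (1 / 50)) (1 / 100) := by
  intro κ hκ
  have e1 : (1 / 20 : ℝ) / 2 = 1 / 40 := by norm_num
  have h := su2_torusClusteringOnBallW_star 20 (βW := 1 / 20) (κ := κ) (ε₀ := 3 / 10) (ε₁ := 1 / 4)
    (c := 2881 / 100000) (lam := 35356 / 100000) (t := 1 / 100) (T₁ := 1010051 / 1000000) (T₂ := 510101 / 500000)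
    (by norm_num) (by norm_num) (by norm_num) (by norm_num) hκ exp_le_3_10_d sqrt_two_le
    exp_le_1_100_w (by rw [show (2:ℝ) * (1 / 100) = 1 / 50 by norm_num]; exact exp_le_1_50_w)
    (by norm_num) (by norm_num) (by norm_num) (by unfold doorPoly; norm_num)
    (by unfold gaugeR Delta; norm_num)
  have e2 : (2 : ℝ) * (1 / 100) = 1 / 50 := by norm_num
  rw [e1, e2] at h
  exact h

/-- g4's **generated cell `(β_W; ε₀, ε₁) = (1/10; 3/10, 17/100)`** (verbatim): tree coupling `0 ≤ β ≤ 1/20`, every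
`κ ≥ 1/100`.  Certificate `c = 1/20`, `λ = 2405/10000`, `K = 20`.  HYPOTHESIS-FREE. -/
theorem su2_torusClusteringOnBallW_star_oneTenth_gen_t100 :
    ∀ κ : ℝ, 1 / 100 ≤ κ → ∀ β : ℝ, 0 ≤ β → β ≤ 1 / 20 →
      TorusClusteringOnBallW 2 4 β κ (3 / 10) (17 / 100) (16 * Real.exp (1 / 50)) (1 / 100) := by
  intro κ hκ
  have e1 : (1 / 10 : ℝ) / 2 = 1 / 20 := by norm_num
  have h := su2_torusClusteringOnBallW_star 20 (βW := 1 / 10) (κ := κ) (ε₀ := 3 / 10) (ε₁ := 17 / 100)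
    (c := 1 / 20) (lam := 2405 / 10000) (t := 1 / 100) (T₁ := 1010051 / 1000000) (T₂ := 510101 / 500000)
    (by norm_num) (by norm_num) (by norm_num) (by norm_num) hκ exp_le_3_10_d sqrt_two_le
    exp_le_1_100_w (by rw [show (2:ℝ) * (1 / 100) = 1 / 50 by norm_num]; exact exp_le_1_50_w)
    (by norm_num) (by norm_num) (by norm_num) (by unfold doorPoly; norm_num)
    (by unfold gaugeR Delta; norm_num)
  have e2 : (2 : ℝ) * (1 / 100) = 1 / 50 := by norm_num
  rw [e1, e2] at h
  exact h

/-- Tree cell `β_W,eff ≤ 1/5`: tree `β₀ = 1/10`, loads `(17/100, 17/200)`. -/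
theorem doorCell_oneFifth : DoorCell (1 / 10) (17 / 100) (17 / 200) :=
  su2_torusClusteringOnBallW_star_oneFifth_t100

/-- Tree cell `β_W,eff ≤ 1/4`: tree `β₀ = 1/8`, loads `(27/250, 27/500)`. -/
theorem doorCell_oneQuarter : DoorCell (1 / 8) (27 / 250) (27 / 500) :=
  su2_torusClusteringOnBallW_star_oneQuarter_t100

/-- Tree cell `β_W,eff ≤ 3/10`: tree `β₀ = 3/20`, loads `(27/500, 27/1000)`. -/
theorem doorCell_threeTenths : DoorCell (3 / 20) (27 / 500) (27 / 1000) :=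
  su2_torusClusteringOnBallW_star_threeTenths_t100

/-- g4's generated cell `β_W,eff ≤ 1/10` with the generous loads `(3/10, 17/100)`: tree `β₀ = 1/20`. -/
theorem doorCell_oneTenth_gen : DoorCell (1 / 20) (3 / 10) (17 / 100) :=
  su2_torusClusteringOnBallW_star_oneTenth_gen_t100

/-- g4's generated cell `β_W,eff ≤ 1/20` with loads `(3/10, 1/4)`: tree `β₀ = 1/40`. -/
theorem doorCell_oneTwentieth_gen : DoorCell (1 / 40) (3 / 10) (1 / 4) :=
  su2_torusClusteringOnBallW_star_oneTwentieth_gen_t100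

/-- A cell is monotone in its coupling range (g4, verbatim). -/
theorem DoorCell.mono {β₀ β₀' ε₀ ε₁ : ℝ} (h : DoorCell β₀ ε₀ ε₁) (hle : β₀' ≤ β₀) : DoorCell β₀' ε₀ ε₁ :=
  fun κ hκ β hβ0 hβ => h κ hκ β hβ0 (hβ.trans hle)

/-- ★ **GENERIC CONSUMER — every cell in Bałaban's currency.**  A door cell `(β₀; ε₀, ε₁)` is fed by strip format
`(r, κ, η)` with thin supports, `κ ≥ 1/100 + δ`, `2η ≤ ε₀` and `8η/(eδr) ≤ ε₁`, at every coupling `0 ≤ β ≤ β₀`. -/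
theorem su2_clustersWith_of_strip_cell {β₀ ε₀ ε₁ : ℝ} (hcell : DoorCell β₀ ε₀ ε₁) (hL : 3 ≤ L) (W : Perturbation 4 L 2)
    {r κ η δ β : ℝ} (hr : 0 < r)
    (hW : W.HasAnalyticNormLE (fundamentalRep (Fin 2)) (fun _ => stripDomain (fundamentalRep (Fin 2)) r) κ η)
    (hsupp : ∀ X, W.act X ≠ 0 → (polymerDiam X : ℝ) ≤ (X.card : ℝ) - 1)
    (hδ : 0 < δ) (hκ : 1 / 100 + δ ≤ κ) (h₀ : 2 * η ≤ ε₀) (h₁ : 8 / (Real.exp 1 * δ * r) * η ≤ ε₁)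
    (hβ0 : 0 ≤ β) (hβ : β ≤ β₀) : ClustersWith W β (16 * Real.exp (1 / 50)) (1 / 100) := by
  have h₁' : 2 * ((4 : ℕ) : ℝ) / (Real.exp 1 * δ * r) * η ≤ ε₁ := by
    have e : (2 : ℝ) * ((4 : ℕ) : ℝ) = 8 := by norm_num
    rw [e]; exact h₁
  exact clustersWith_of_strip (hcell (1 / 100) le_rfl β hβ0 hβ) hL W hr hW hsupp (by norm_num) hδ hκ h₀ h₁'

/-- Row `β_W,eff ≤ 1/5` in Bałaban's currency: `2η ≤ 17/100`, `8η/(eδr) ≤ 17/200`. -/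
theorem su2_clustersWith_of_strip_oneFifth (hL : 3 ≤ L) (W : Perturbation 4 L 2) {r κ η δ β : ℝ} (hr : 0 < r)
    (hW : W.HasAnalyticNormLE (fundamentalRep (Fin 2)) (fun _ => stripDomain (fundamentalRep (Fin 2)) r) κ η)
    (hsupp : ∀ X, W.act X ≠ 0 → (polymerDiam X : ℝ) ≤ (X.card : ℝ) - 1)
    (hδ : 0 < δ) (hκ : 1 / 100 + δ ≤ κ) (h₀ : 2 * η ≤ 17 / 100) (h₁ : 8 / (Real.exp 1 * δ * r) * η ≤ 17 / 200)
    (hβ0 : 0 ≤ β) (hβ : β ≤ 1 / 10) : ClustersWith W β (16 * Real.exp (1 / 50)) (1 / 100) :=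
  su2_clustersWith_of_strip_cell doorCell_oneFifth hL W hr hW hsupp hδ hκ h₀ h₁ hβ0 hβ

/-- Row `β_W,eff ≤ 1/4`: `2η ≤ 27/250`, `8η/(eδr) ≤ 27/500`. -/
theorem su2_clustersWith_of_strip_oneQuarter (hL : 3 ≤ L) (W : Perturbation 4 L 2) {r κ η δ β : ℝ} (hr : 0 < r)
    (hW : W.HasAnalyticNormLE (fundamentalRep (Fin 2)) (fun _ => stripDomain (fundamentalRep (Fin 2)) r) κ η)
    (hsupp : ∀ X, W.act X ≠ 0 → (polymerDiam X : ℝ) ≤ (X.card : ℝ) - 1)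
    (hδ : 0 < δ) (hκ : 1 / 100 + δ ≤ κ) (h₀ : 2 * η ≤ 27 / 250) (h₁ : 8 / (Real.exp 1 * δ * r) * η ≤ 27 / 500)
    (hβ0 : 0 ≤ β) (hβ : β ≤ 1 / 8) : ClustersWith W β (16 * Real.exp (1 / 50)) (1 / 100) :=
  su2_clustersWith_of_strip_cell doorCell_oneQuarter hL W hr hW hsupp hδ hκ h₀ h₁ hβ0 hβ

/-- Row `β_W,eff ≤ 3/10`: `2η ≤ 27/500`, `8η/(eδr) ≤ 27/1000`. -/
theorem su2_clustersWith_of_strip_threeTenths (hL : 3 ≤ L) (W : Perturbation 4 L 2) {r κ η δ β : ℝ} (hr : 0 < r)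
    (hW : W.HasAnalyticNormLE (fundamentalRep (Fin 2)) (fun _ => stripDomain (fundamentalRep (Fin 2)) r) κ η)
    (hsupp : ∀ X, W.act X ≠ 0 → (polymerDiam X : ℝ) ≤ (X.card : ℝ) - 1)
    (hδ : 0 < δ) (hκ : 1 / 100 + δ ≤ κ) (h₀ : 2 * η ≤ 27 / 500) (h₁ : 8 / (Real.exp 1 * δ * r) * η ≤ 27 / 1000)
    (hβ0 : 0 ≤ β) (hβ : β ≤ 3 / 20) : ClustersWith W β (16 * Real.exp (1 / 50)) (1 / 100) :=
  su2_clustersWith_of_strip_cell doorCell_threeTenths hL W hr hW hsupp hδ hκ h₀ h₁ hβ0 hβ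

/-- Row `β_W,eff ≤ 1/10` (generous loads): `2η ≤ 3/10`, `8η/(eδr) ≤ 17/100`. -/
theorem su2_clustersWith_of_strip_oneTenth_gen (hL : 3 ≤ L) (W : Perturbation 4 L 2) {r κ η δ β : ℝ} (hr : 0 < r)
    (hW : W.HasAnalyticNormLE (fundamentalRep (Fin 2)) (fun _ => stripDomain (fundamentalRep (Fin 2)) r) κ η)
    (hsupp : ∀ X, W.act X ≠ 0 → (polymerDiam X : ℝ) ≤ (X.card : ℝ) - 1)
    (hδ : 0 < δ) (hκ : 1 / 100 + δ ≤ κ) (h₀ : 2 * η ≤ 3 / 10) (h₁ : 8 / (Real.exp 1 * δ * r) * η ≤ 17 / 100)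
    (hβ0 : 0 ≤ β) (hβ : β ≤ 1 / 20) : ClustersWith W β (16 * Real.exp (1 / 50)) (1 / 100) :=
  su2_clustersWith_of_strip_cell doorCell_oneTenth_gen hL W hr hW hsupp hδ hκ h₀ h₁ hβ0 hβ

/-- Row `β_W,eff ≤ 1/20`: `2η ≤ 3/10`, `8η/(eδr) ≤ 1/4`. -/
theorem su2_clustersWith_of_strip_oneTwentieth_gen (hL : 3 ≤ L) (W : Perturbation 4 L 2) {r κ η δ β : ℝ} (hr : 0 < r)
    (hW : W.HasAnalyticNormLE (fundamentalRep (Fin 2)) (fun _ => stripDomain (fundamentalRep (Fin 2)) r) κ η)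
    (hsupp : ∀ X, W.act X ≠ 0 → (polymerDiam X : ℝ) ≤ (X.card : ℝ) - 1)
    (hδ : 0 < δ) (hκ : 1 / 100 + δ ≤ κ) (h₀ : 2 * η ≤ 3 / 10) (h₁ : 8 / (Real.exp 1 * δ * r) * η ≤ 1 / 4)
    (hβ0 : 0 ≤ β) (hβ : β ≤ 1 / 40) : ClustersWith W β (16 * Real.exp (1 / 50)) (1 / 100) :=
  su2_clustersWith_of_strip_cell doorCell_oneTwentieth_gen hL W hr hW hsupp hδ hκ h₀ h₁ hβ0 hβ

namespace SU2

variable {b S : ℕ} [NeZero b] [NeZero S]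

/-- Block level, remaining cells: `GibbsFormAtStripDoor` of the cell ⇒ `BlockClusters` (`1/5`, `1/4`, `3/10`, the two
generated cells) — instances of `blockClusters_of_gibbsFormAtStripDoor`. -/
theorem blockClusters_of_stripDoor_oneFifth (hS : 3 ≤ S) {B : GaugeBlockAveraging 4 (SUN 2) b S} {β : ℝ}
    (h : GibbsFormAtStripDoor B β (1 / 10) (17 / 100) (17 / 200)) : BlockClusters B β (16 * Real.exp (1 / 50)) (1 / 100) :=
  blockClusters_of_gibbsFormAtStripDoor hS doorCell_oneFifth h

/-- Gibbs form at the strip door of the `1/4` cell ⇒ block-level IR. -/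
theorem blockClusters_of_stripDoor_oneQuarter (hS : 3 ≤ S) {B : GaugeBlockAveraging 4 (SUN 2) b S} {β : ℝ}
    (h : GibbsFormAtStripDoor B β (1 / 8) (27 / 250) (27 / 500)) : BlockClusters B β (16 * Real.exp (1 / 50)) (1 / 100) :=
  blockClusters_of_gibbsFormAtStripDoor hS doorCell_oneQuarter h

/-- Gibbs form at the strip door of the `3/10` cell ⇒ block-level IR. -/
theorem blockClusters_of_stripDoor_threeTenths (hS : 3 ≤ S) {B : GaugeBlockAveraging 4 (SUN 2) b S} {β : ℝ}
    (h : GibbsFormAtStripDoor B β (3 / 20) (27 / 500) (27 / 1000)) : BlockClusters B β (16 * Real.exp (1 / 50)) (1 / 100) :=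
  blockClusters_of_gibbsFormAtStripDoor hS doorCell_threeTenths h

/-- Gibbs form at the strip door of the generous `1/10` cell ⇒ block-level IR. -/
theorem blockClusters_of_stripDoor_oneTenth_gen (hS : 3 ≤ S) {B : GaugeBlockAveraging 4 (SUN 2) b S} {β : ℝ}
    (h : GibbsFormAtStripDoor B β (1 / 20) (3 / 10) (17 / 100)) : BlockClusters B β (16 * Real.exp (1 / 50)) (1 / 100) :=
  blockClusters_of_gibbsFormAtStripDoor hS doorCell_oneTenth_gen h

/-- Gibbs form at the strip door of the generous `1/20` cell ⇒ block-level IR. -/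
theorem blockClusters_of_stripDoor_oneTwentieth_gen (hS : 3 ≤ S) {B : GaugeBlockAveraging 4 (SUN 2) b S} {β : ℝ}
    (h : GibbsFormAtStripDoor B β (1 / 40) (3 / 10) (1 / 4)) : BlockClusters B β (16 * Real.exp (1 / 50)) (1 / 100) :=
  blockClusters_of_gibbsFormAtStripDoor hS doorCell_oneTwentieth_gen h

end SU2

end Summit.Ventures.YMGap.YM4Door

end
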